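import Summits.BirchSwinnertonDyer.Rank1Residual.X11b.BDPRouteOpenInputField
import HarnessLib

/-!
# Class X11b, route p2 at `p ≥ 5`: THE OPEN INPUT AT ITS WEAKEST IN THE DATUM DIRECTION (II) —
# SUPPLY: Hoffstein–Luo gives admissible Heegner fields with ANY finite set of primes split,
# `d_K ≡ 1 (mod 8)` and `|d_K|` as large as wanted, so the composite open input over such fields
# ONLY already gives `BSD(E,p)` on the Locus (cell `b2b-bsdres`, sub-cell `multr1-p2`, gen 27;
# file 2 of 3)

HONEST FRAMING (cell `b2b-bsdres`, run/shared/lean/b2b/bsd-rank1-residual/, verbatim in every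
file): the goal of the cell is to DELETE the COMBINATION-SHAPED residual classes of the
Birch–Swinnerton-Dyer formula for ALL analytic-rank `≤ 1` elliptic curves over `ℚ` — "full BSD
formula for every rank `≤ 1` curve in class `C`" assembled STRICTLY from published theorems — so
that the rank-`≤ 1` remainder becomes exactly the CONSTRUCTION-SHAPED classes, which are TYPED
(missing-input `Prop`s), NOT attempted. This is not "finishing BSD". Sub-cell `multr1-p2` is a
RESEARCH ROUTE on class X11b (`ClassX11b W p := r_an = 1 ∧ p ≠ 2 ∧ mult(p) ∧ irr(p)`); no claim
beyond the stated class and loci; X11b's label does not change; NOTHING is booked by this file.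

THEOREMS ONLY (no definition, no named fact, no `sorry`). The PUBLISHED fact consumed is the tree's
`HoffsteinLuo1997_exists_twist_L_one_ne_zero` (as a hypothesis `hHL`, as everywhere in the route).

## What this file proves

* `exists_admissibleField_splitAt`: for `E` of root number `−1`, every finite set `S` of primes and
  bound `B` there is an imaginary quadratic `K` with `d_K ≡ 1 (mod 8)`, `B < |d_K|`, every prime of
  `N_E`, the prime `p` and every `q ∈ S` SPLIT in `K`, and `L(E^{d_K},1) ≠ 0`
  (`exists_admissibleField_of_rootNumber_eq_neg_one` is `S = ∅`, `B = 4`); `admissible_of_discr_mod_eight`: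
  such a `K` is p2-admissible (`d_K` odd, `p ∤ d_K`, `p ∤ w_K`) at odd `p`.
* **`P2.bsdp_of_locus_of_openInputAt_prescribedFields`**: for ANY `S`, `B` (the source's choice):
  if route p2's composite open input holds over every imaginary quadratic `K` with
  `d_K ≡ 1 (mod 8)`, `|d_K| > B`, the primes of `S` split and `L(E^{d_K},1) ≠ 0`, then `BSD(E,p)` on
  every Locus pair (`(ram) ∧ p ∤ ∏ c_ℓ`; 2 093 111 ‖ 61 629).

Reading for the registry: hypotheses of a refereed source on the auxiliary field of this LOCAL kind
(finitely many split primes, `2` split, `d_K` odd / large) cost the route nothing; a CLASS-NUMBER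
hypothesis (`p ∤ h_K`) is NOT supplied by Hoffstein–Luo and would remain typed. CONDITIONAL on the
open input (PRE at `p ∥ N`); nothing booked; labels UNCHANGED; X11b stays CONSTRUCTION-SHAPED.

## References

* [HoffsteinLuo1997] J. Hoffstein, W. Luo, *Nonvanishing of `L`-series and the combinatorial
  sieve*, Math. Res. Lett. 4 (1997), Theorem. * [GrossLMS1991] §1 (p. 235).
* [Castella2018] Thm. 3.2, §5 (arXiv:1704.06608 pp. 9, 12). * [Castella2018Erratum] (2.4) (p. 4).
-/

noncomputable section

open scoped Classical NumberField

open WeierstrassCurve NumberField IsDedekindDomain Field PowerSeries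
open Literature.NumberTheory.EllipticCurves Literature.NumberTheory.EllipticCurves.GreenbergSelmer
  Literature.NumberTheory.EllipticCurves.ModularForms
  Literature.NumberTheory.EllipticCurves.Rank1Residual
  Literature.NumberTheory.EllipticCurves.Rank1Residual.Typed
  Literature.NumberTheory.EllipticCurves.Wuthrich2014
  Literature.NumberTheory.EllipticCurves.Castella2018
  Literature.NumberTheory.EllipticCurves.BalakrishnanEtAl2019
  Literature.NumberTheory.QuadraticFields.Quadratic
  Literature.NumberTheory.Automorphic
  Literature.NumberTheory.GaloisRepresentations Literature.NumberTheory.GaloisCohomology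
  Summit.BirchSwinnertonDyer.Rank1Residual.X11b.AcSelmer
  Summit.BirchSwinnertonDyer.Rank1Residual.X11b.LocBridge
  Summit.BirchSwinnertonDyer.Rank1Residual.X11b.CongruenceLimit
  Summit.BirchSwinnertonDyer.Rank1Residual.X11b.Halves

namespace Summit.BirchSwinnertonDyer.Rank1Residual.X11b

/-! ### §4 Supply: admissible fields with prescribed split primes (Hoffstein–Luo) -/

section Supply

variable (W : WeierstrassCurve ℚ) [W.IsElliptic] [W.IsGloballyMinimal] (p : ℕ) [Fact p.Prime]

omit [W.IsGloballyMinimal] in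
/-- **Admissible Heegner fields with prescribed splitting (Hoffstein–Luo 1997, PUBLISHED).** For
`E` of root number `−1`, any finite set `S` of primes and any bound `B`: an imaginary quadratic `K`
with `d_K ≡ 1 (mod 8)` (so `d_K` odd and `2` split), `B < |d_K|`, every prime dividing `N_E`, the
prime `p` and every prime of `S` SPLIT in `K` (`SatisfiesHeegnerHypothesis`: the strict, all-split
Heegner hypothesis of the tree), and `L(E^{d_K}, 1) ≠ 0`. (`exists_admissibleField_of_rootNumber_eq_neg_one`
is the case `S = ∅`, `B = 4`.) [cite: HoffsteinLuo1997, Theorem] [cite: GrossLMS1991, §1 (p. 235)] -/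
theorem exists_admissibleField_splitAt (hnf : exists_isNewformOf)
    (hHL : HoffsteinLuo1997_exists_twist_L_one_ne_zero) (hw : W.rootNumber = -1)
    (S : Finset ℕ) (hS : ∀ q ∈ S, q.Prime) (B : ℕ) :
    ∃ (K : Type) (_ : Field K) (_ : NumberField K), IsImaginaryQuadratic K ∧
      NumberField.discr K % 8 = 1 ∧ B < (NumberField.discr K).natAbs ∧
      SatisfiesHeegnerHypothesis (W.conductorNorm ℤ) K ∧ SatisfiesHeegnerHypothesis p K ∧
      (∀ q ∈ S, SatisfiesHeegnerHypothesis q K) ∧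
      (W.quadraticTwist (NumberField.discr K : ℚ)).entireLFunction 1 ≠ 0 := by
  have hpP : p.Prime := Fact.out
  obtain ⟨d, hdneg, hsq, hd8, hB, hjacS, hjacN, hL⟩ :=
    exists_neg_fundamental_twist_ne_zero_of_hoffsteinLuo hnf hHL W hw (insert p S) B
  -- the level `M = N_E · p · ∏ S` (every prime factor of `M` must split)
  set M : ℕ := W.conductorNorm ℤ * p * ∏ q ∈ S, q with hM
  have hkr : ∀ q : ℕ, q.Prime → q ∣ M →
      (q = 2 → d % 8 = 1) ∧ (q ≠ 2 → jacobiSym d q = 1) := by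
    intro q hq hqM
    refine ⟨fun _ ↦ hd8, fun hq2 ↦ ?_⟩
    rcases (Nat.Prime.dvd_mul hq).mp hqM with hqNp | hqS
    · rcases (Nat.Prime.dvd_mul hq).mp hqNp with hqN | hqp
      · exact hjacN q hq hqN hq2
      · have hqp' : q = p := (Nat.prime_dvd_prime_iff_eq hq hpP).mp hqp
        subst hqp'
        exact hjacS q (Finset.mem_insert_self q S) hq hq2
    · obtain ⟨r, hrS, hqr⟩ := (Prime.dvd_finsetProd_iff hq.prime _).mp hqS
      have hqr' : q = r := (Nat.prime_dvd_prime_iff_eq hq (hS r hrS)).mp hqr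
      subst hqr'
      exact hjacS q (Finset.mem_insert_of_mem hrS) hq hq2
  obtain ⟨K, _, _, hK, hBK, hH, hd8K, hLK⟩ :=
    (exists_heegnerField_iff_exists_fundamental M B
      (fun D ↦ D % 8 = 1 ∧ (W.quadraticTwist (D : ℚ)).entireLFunction 1 ≠ 0)).mpr
      ⟨d, hdneg, Or.inl ⟨by omega, hsq, by omega⟩, hB, hkr, hd8, hL⟩
  have hSM : (∏ q ∈ S, q) ∣ M := ⟨W.conductorNorm ℤ * p, by rw [hM]; ring⟩
  exact ⟨K, inferInstance, inferInstance, hK, hd8K, hBK, hH.of_dvd ⟨p * ∏ q ∈ S, q, by rw [hM]; ring⟩,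
    hH.of_dvd ⟨W.conductorNorm ℤ * ∏ q ∈ S, q, by rw [hM]; ring⟩,
    fun q hq ↦ hH.of_dvd ((Finset.dvd_prod_of_mem (fun q : ℕ ↦ q) hq).trans hSM), hLK⟩

/-- From `d_K ≡ 1 (mod 8)`, `|d_K| > 4`, `p` odd and split: the p2-admissibility clauses `d_K` odd,
`p ∤ d_K`, `p ∤ w_K`. [folklore] -/
theorem admissible_of_discr_mod_eight {K : Type} [Field K] [NumberField K]
    (hK : IsImaginaryQuadratic K) (hd8 : NumberField.discr K % 8 = 1)
    (hB : 4 < (NumberField.discr K).natAbs) (hp2 : p ≠ 2) (hHp : SatisfiesHeegnerHypothesis p K) :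
    Odd (NumberField.discr K) ∧ ¬ (p : ℤ) ∣ NumberField.discr K ∧ ¬ p ∣ Units.torsionOrder K := by
  have hp : p.Prime := Fact.out
  have hneg : NumberField.discr K < 0 := IsImaginaryQuadratic.discr_neg hK
  refine ⟨Int.odd_iff.mpr (by omega), not_dvd_discr_of_split hK hp hp2 hHp, ?_⟩
  haveI : IsTotallyComplex K := hK.2
  have hlt : NumberField.discr K < -4 := by
    have h4 : 4 < (NumberField.discr K).natAbs := hB
    omega
  rw [Literature.NumberTheory.DiophantineGeometry.torsionOrder_eq_two_of_discr_lt hK.1 hlt]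
  intro h2
  have := Nat.le_of_dvd two_pos h2
  have := hp.two_le
  omega

/-- **A1 — `BSD(E,p)` ON THE LOCUS FROM THE INPUT OVER THE PRESCRIBED FIELDS.** For ANY finite set
`S` of primes and bound `B` (the source's choice): if route p2's composite open input holds over every
imaginary quadratic `K` with `d_K ≡ 1 (mod 8)`, `|d_K| > B`, every prime of `S` (and of `N_E p`)
split in `K` and `L(E^{d_K},1) ≠ 0`, then `BSD(E,p)` for every Locus pair — Hoffstein–Luo supplies
such a field, §2 consumes it. CONDITIONAL on that input (OPEN at `p ∥ N`); nothing booked.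
[cite: HoffsteinLuo1997, Theorem] [cite: Castella2018Erratum, (2.4) (p. 4)] [cite: Castella2018, Thm. 3.2, §5]
[cite: Skinner2016PacificMC, Thm. C (§1)] [cite: McCallumLMS1991, §1 Theorem (Kolyvagin), p. 296] -/
theorem P2.bsdp_of_locus_of_openInputAt_prescribedFields
    (hGZ : ∀ (N : ℕ) [NeZero N] (W : WeierstrassCurve ℚ) (K : Type) [Field K] [NumberField K],
      gross_zagier N W K)
    (hKo : ∀ (N : ℕ) [NeZero N] (W : WeierstrassCurve ℚ) (K : Type) [Field K] [NumberField K],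
      kolyvagin N W K)
    (hB : ∀ (N : ℕ) [NeZero N] (W : WeierstrassCurve ℚ) (K : Type) [Field K] [NumberField K],
      Kolyvagin1990_padicValNat_card_sha_le N W K)
    (hSk : Skinner2016.thmC_padicValRat_bsd_rank_zero) (hWu : sha_dvd_analyticSha)
    (hGZK : rank_eq_analyticRank_of_analyticRank_le_one) (hmod : hasEntireLFunction_rat)
    (hnf : exists_isNewformOf) (hHL : HoffsteinLuo1997_exists_twist_L_one_ne_zero)
    (hMaz : mazur_not_dvd_maninConstant_of_odd)
    (hPT : ∀ (K : Type) [Field K] [NumberField K], poitouTate_sum_localTatePairing_eq_zero K)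
    (hEP : ∀ (K : Type) [Field K] [NumberField K] (v : HeightOneSpectrum (𝓞 K)),
      localEulerPoincareCharacteristic (v.adicCompletion K))
    -- the source's hypotheses on the field: a finite set of split primes and a bound
    (S : Finset ℕ) (hS : ∀ q ∈ S, q.Prime) (B : ℕ)
    -- THE open input, over the prescribed fields only
    (hA : ∀ (K : Type) [Field K] [NumberField K], IsImaginaryQuadratic K →
      NumberField.discr K % 8 = 1 → B < (NumberField.discr K).natAbs →
      (∀ q ∈ S, SatisfiesHeegnerHypothesis q K) →
      (W.quadraticTwist (NumberField.discr K : ℚ)).entireLFunction 1 ≠ 0 →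
      P2.OpenInputOnTreeAtField W p K)
    -- the pair: on the Locus
    (hX : ClassX11b W p) (hp5 : 5 ≤ p) (hram : Ram W p) (htam : ¬ p ∣ W.tamagawaProduct) :
    BSDp W p := by
  have hr : W.analyticRank = 1 := hX.1
  have hp2 : p ≠ 2 := hX.2.1
  have hw : W.rootNumber = -1 := by
    rw [WeierstrassCurve.rootNumber_eq_neg_one_pow_analyticRank_of_exists_isNewformOf hnf W, hr]
    norm_num
  -- a Hoffstein–Luo field with `S` split and `|d_K| > max B 4`
  obtain ⟨K, _, _, hK, hd8, hBK, hHN, hHp, hHS, hLt⟩ :=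
    exists_admissibleField_splitAt W p hnf hHL hw S hS (max B 4)
  have hB' : B < (NumberField.discr K).natAbs := lt_of_le_of_lt (le_max_left _ _) hBK
  have h4 : 4 < (NumberField.discr K).natAbs := lt_of_le_of_lt (le_max_right _ _) hBK
  obtain ⟨hodd, hpd, hμ⟩ := admissible_of_discr_mod_eight p hK hd8 h4 hp2 hHp
  exact P2.bsdp_of_locus_of_openInputAtField W p hGZ hKo hB hSk hWu hGZK hmod hnf hHL hMaz hPT hEP
    hK hodd hpd hμ hHN hLt (hA K hK hd8 hB' hHS hLt) hX hp5 hram htam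

end Supply

end Summit.BirchSwinnertonDyer.Rank1Residual.X11b

end
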